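import Summits.BirchSwinnertonDyer.BirchSwinnertonDyer.Theorems.EisensteinPrimesAcTwistDeformationCurveCotorsion
import Summits.BirchSwinnertonDyer.BirchSwinnertonDyer.Theorems.EisensteinPrimesUnramifiedOutsideRamification
import Literature.NumberTheory.EllipticCurves.BigRepModuleShapiroSurjectiveProofs
import Literature.GroupTheory.PadicQuotientSectionProofs
import Literature.GroupTheory.ProfiniteSubquotients
import HarnessLib

/-!
# The one-variable Shapiro descent `F : H¹(K_Σ/K, 𝐃₁) → H¹(K_∞, M)` is ONTO the classes unramified outside `S`, and the
# CONVERSE local dictionary «every conjugate of `F[c]` locally trivial above `w` ⟹ `loc_w[c] = 0`»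
# (cell `bsd-eis`, width seat `bsd-line-x2-p2` gen 7; crux 4 `BSDpOnCellC` stmt-BirchSwinnertonDyer-19034, line b1 v12; sequel of
# `…AcTwistDeformationCurveAlmostDivisible`, generic part)

HONEST FRAMING (cell `bsd-eis`, run/shared/lean/pub/bsd-eis/): Galois-cohomological plumbing on constructed objects; no
definition, no named fact, no `sorry`, no `Theses` import; nothing about BSD or a main conjecture is asserted; nothing booked;
no label or count moves. Helper `--supports stmt-BirchSwinnertonDyer-19034`; closes no stub. UNCONDITIONAL.

## Why

Greenberg 2016 Prop. 4.1.1 (c) makes `S_{𝓛^{v̄}}(K, 𝐃_E)` almost divisible (`…CurveAlmostDivisible`, p651263). To move «no finite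
`Λ`-submodule» to Castella's `Sf`-imprimitive dual `𝔛^{Sf}_f = XAc E_K p κ v̄ ↑Sf γ` (the one E-level input of crux 4's [ALG-imp]
λ-EQUALITY at non-split `p ‖ N`, g6 p649247) the descent `F` must identify `S_{𝓛^{v̄}}(K, 𝐃_E)` with `Sel^{Sf}_{v̄}(K_∞, E[p^∞])`
EXACTLY — LEAD g2's road (A) (`…AcTwistDeformationShapiro`, p62xxxx) has `F` injective, `T ↦ conj_γ − 1`, and the local
dictionary in the direction `loc_w = 0 ⟹ locally trivial`; x1-w3 g3 (`…CurveCotorsion`) has INTO for the fullAt/primitive pair.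
THIS FILE supplies the two missing generic directions (for ANY `p`-primary `A`, equivariant `ψ : A ≃+ M`, `S ⊇ {w ∣ p}`):

* `ramificationSubgroup_le_kerSubgroup_of_hS` (`N_S ≤ ker κ`); `exists_cocycle_descent₁` — a continuous cocycle of `ker κ` with
  values in `M` vanishing on `N_S` descends to a continuous cocycle of `ρ₀` on `Gal(K_S/K_∞) = galoisGroupAbove S (ker κ)`
  (one-variable twin of k5-c2 g9's `GreenbergFullAtSelmer.exists_cocycle_descent`);
* `exists_shapiroDescent_eq_of_apply_ramificationSubgroup_eq_zero`, **`exists_shapiroDescent_eq_of_mem_unramifiedOutside`** —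
  `F` is ONTO `GreenbergVatsal2000.unramifiedOutside (ker κ) M p S`: w4 g4's `resOfLe_eq_zero_of_mem_unramifiedOutside` (vanishing
  on `N_Σ`) + descent + bsd-stepL's cocycle-level Shapiro surjectivity `BigRepModule.exists_cocycle_apply_zero_eq` with the
  continuous homomorphic section of `κ̄` (`Literature.GroupTheory.exists_continuousMonoidHom_section_padicInt`, `G_{K,S}` profinite);
* **`loc_eq_zero_of_forall_conjH1_shapiroDescent_mem_awayKer`** — the CONVERSE of LEAD g2's
  `conjH1_shapiroDescent_mem_awayKer_of_loc_eq_zero`: if every conjugate `conj_σ(F[c])` is locally trivial above the finite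
  place `w` over `K_∞` then `loc_w[c] = 0` (bsd-stepL's iff `exists_eq_bigRep_sub_comp_iff`, `rho_apply_conj_zero`, `κ` onto).

The curve instance (`F(S_{𝓛^{v̄}}(K, 𝐃_E)) = selmerAc W p κ v̄ Sf` and `corank_Λ S_{𝓛^{v̄}} = 0` from the cotorsion of `𝔛^{Sf}_f`) is
the next file. References: [Greenberg2006] Thm. 3 p. 342 ("as `Λ`-modules"); [SkinnerUrban2014] §3.1.2, Prop. 3.2.3;
[SerreGaloisCohomology1997] I §2.5, §5.1; [NeukirchSchmidtWingberg2008] (1.6.7), VIII §3; [GreenbergVatsal2000] §2 pp. 16–17, 23.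
-/

set_option autoImplicit false
set_option linter.dupNamespace false -- the summit namespace `…BirchSwinnertonDyer.BirchSwinnertonDyer.Theorems` (Sub = Summit, D-0017) trips it

noncomputable section

open scoped Classical
open NumberField IsDedekindDomain Field Multiplicative PowerSeries
open Literature.NumberTheory.EllipticCurves Literature.NumberTheory.EllipticCurves.GreenbergSelmer
  Literature.NumberTheory.EllipticCurves.GreenbergVatsal2000 Literature.NumberTheory.GaloisRepresentations
  Literature.NumberTheory.EllipticCurves.IwasawaDual Literature.NumberTheory.EllipticCurves.Castella2018.AcSelmer
  Literature.NumberTheory.IwasawaTheory Literature.NumberTheory.IwasawaTheory.Greenberg2016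
  Literature.NumberTheory.IwasawaTheory.Greenberg2006
  Summit.BirchSwinnertonDyer.BirchSwinnertonDyer.Theorems.GreenbergFullAtSelmer
  Summit.BirchSwinnertonDyer.BirchSwinnertonDyer.Theorems.UnramifiedInflation

namespace Summit.BirchSwinnertonDyer.BirchSwinnertonDyer.Theorems.AcTwistDeformation

/-! ## Descent to `Gal(K_S/K_∞)`, surjectivity onto the classes unramified outside `S`, the converse local dictionary -/

section Onto

variable {K : Type} [Field K] [NumberField K] (S : Set (HeightOneSpectrum (𝓞 K))) {p : ℕ} [Fact p.Prime]
  {A : Type} [AddCommGroup A] [Module ℤ_[p] A] [TopologicalSpace A] [DiscreteTopology A]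
  [TopologicalSpace (PowerSeries ℤ_[p])] [IsTopologicalAddGroup (BigRepModule ℤ_[p] p A)]
  [ContinuousSMul (PowerSeries ℤ_[p]) (BigRepModule ℤ_[p] p A)]
  (hS : ∀ v : HeightOneSpectrum (𝓞 K), ((p : ℕ) : 𝓞 K) ∈ v.asIdeal → v ∈ S)
  (κ : ZpExtension K p) (ρ₀ : ContinuousRep (GaloisGroupUnramifiedOutside K S) ℤ_[p] A)
  {M : Type} [AddCommGroup M] [DistribMulAction (absoluteGaloisGroup K) M] [TopologicalSpace M]
  [DiscreteTopology M]
  (ψ : A ≃+ M) (hψ : ∀ (σ : absoluteGaloisGroup K) (a : A), ψ (ρ₀ (toUnramifiedQuot K S σ) a) = σ • ψ a)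

omit [IsTopologicalAddGroup (BigRepModule ℤ_[p] p A)] [ContinuousSMul (PowerSeries ℤ_[p]) (BigRepModule ℤ_[p] p A)]
  [TopologicalSpace (PowerSeries ℤ_[p])] in
include hS in
/-- `N_S ≤ ker κ` for `S ⊇ {w ∣ p}`: `κ` factors through `G_{K,S}` (`ZpExtension.liftUnramifiedOutside`).
[cite: Greenberg2006, p. 341 L39–45, p. 342 L2–4] -/
theorem ramificationSubgroup_le_kerSubgroup_of_hS : ramificationSubgroup K S ≤ κ.kerSubgroup := fun n hn ↦ by
  have h1 : toUnramifiedQuot K S n = 1 := (QuotientGroup.eq_one_iff n).mpr hn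
  rw [ZpExtension.mem_kerSubgroup, ← ZpExtension.liftUnramifiedOutside_mk S κ hS n, h1, map_one]

omit [IsTopologicalAddGroup (BigRepModule ℤ_[p] p A)] [ContinuousSMul (PowerSeries ℤ_[p]) (BigRepModule ℤ_[p] p A)]
  [TopologicalSpace (PowerSeries ℤ_[p])] [DiscreteTopology A] in
include hψ in
/-- **Descent (one `ℤ_p`-extension).** A continuous crossed homomorphism `f` of `ker κ = Gal(K̄/K_∞)` with values in `M`
which vanishes on `N_S` descends, through the equivariant `ψ : A ≃+ M`, to a continuous cocycle `z` of `ρ₀` on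
`Gal(K_S/K_∞) = galoisGroupAbove S (ker κ) ≤ G_{K,S}` with `ψ (z s̄) = f s`: well defined since two lifts differ by `N_S`,
continuous since `ker κ ↠ Gal(K_S/K_∞)` is a quotient map (compact onto Hausdorff). One-variable twin of
`GreenbergFullAtSelmer.exists_cocycle_descent`. [cite: NeukirchSchmidtWingberg2008, (1.6.7), VIII §3] -/
theorem exists_cocycle_descent₁ (f : contOneCocycles (discreteTopRep κ.kerSubgroup M))
    (hf0 : ∀ (n : absoluteGaloisGroup K) (hn : n ∈ ramificationSubgroup K S),
      f.1 ⟨n, ramificationSubgroup_le_kerSubgroup_of_hS S hS κ hn⟩ = 0) :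
    ∃ z : galoisGroupAbove S κ.kerSubgroup → A, Continuous z ∧
      (∀ h₁ h₂ : galoisGroupAbove S κ.kerSubgroup,
        z (h₁ * h₂) = z h₁ + ρ₀ (h₁ : GaloisGroupUnramifiedOutside K S) (z h₂)) ∧
      ∀ (s : κ.kerSubgroup) (h : galoisGroupAbove S κ.kerSubgroup),
        toUnramifiedQuot K S (s : absoluteGaloisGroup K) = h → ψ (z h) = f.1 s := by
  haveI : CompactSpace (absoluteGaloisGroup K) := absoluteGaloisGroup_compactSpace K
  haveI : CompactSpace κ.kerSubgroup := isCompact_iff_compactSpace.mp κ.isClosed_kerSubgroup.isCompact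
  -- any lift of an element of `Gal(K_S/K_∞)` lies in `ker κ`
  have hmemK : ∀ (s : absoluteGaloisGroup K) (h : galoisGroupAbove S κ.kerSubgroup),
      toUnramifiedQuot K S s = h → s ∈ κ.kerSubgroup := by
    intro s h hs
    obtain ⟨σ, hσ, hσh⟩ := (mem_galoisGroupAbove_iff S κ.kerSubgroup (h : GaloisGroupUnramifiedOutside K S)).1 h.2
    have hn : σ⁻¹ * s ∈ ramificationSubgroup K S := QuotientGroup.eq.mp (hσh.trans hs.symm)
    have : s = σ * (σ⁻¹ * s) := by rw [mul_inv_cancel_left]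
    rw [this]
    exact mul_mem hσ (ramificationSubgroup_le_kerSubgroup_of_hS S hS κ hn)
  have hout : ∀ h : galoisGroupAbove S κ.kerSubgroup,
      toUnramifiedQuot K S (Quotient.out (h : GaloisGroupUnramifiedOutside K S)) = h :=
    fun h ↦ QuotientGroup.out_eq' (h : GaloisGroupUnramifiedOutside K S)
  -- two lifts give the same value of `f`
  have hwd : ∀ (s t : absoluteGaloisGroup K) (hs : s ∈ κ.kerSubgroup) (ht : t ∈ κ.kerSubgroup),
      toUnramifiedQuot K S s = toUnramifiedQuot K S t → f.1 ⟨s, hs⟩ = f.1 ⟨t, ht⟩ := by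
    intro s t hs ht hst
    have hn : s⁻¹ * t ∈ ramificationSubgroup K S := QuotientGroup.eq.mp hst
    have heq : (⟨t, ht⟩ : κ.kerSubgroup) = ⟨s, hs⟩ * ⟨s⁻¹ * t, ramificationSubgroup_le_kerSubgroup_of_hS S hS κ hn⟩ :=
      Subtype.ext (by simp [mul_inv_cancel_left])
    rw [heq, f.2, hf0 _ hn, map_zero, add_zero]
  let z : galoisGroupAbove S κ.kerSubgroup → A := fun h ↦
    ψ.symm (f.1 ⟨Quotient.out (h : GaloisGroupUnramifiedOutside K S), hmemK _ h (hout h)⟩)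
  have hzval : ∀ (s : κ.kerSubgroup) (h : galoisGroupAbove S κ.kerSubgroup),
      toUnramifiedQuot K S (s : absoluteGaloisGroup K) = h → ψ (z h) = f.1 s := by
    intro s h hs
    simp only [z, AddEquiv.apply_symm_apply]
    exact hwd _ _ _ s.2 ((hout h).trans hs.symm)
  refine ⟨z, ?_, ?_, hzval⟩
  · -- continuity through the quotient map `ker κ ↠ Gal(K_S/K_∞)`
    let q : κ.kerSubgroup → galoisGroupAbove S κ.kerSubgroup := fun s ↦
      ⟨toUnramifiedQuot K S (s : absoluteGaloisGroup K), Subgroup.mem_map_of_mem _ s.2⟩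
    have hqc : Continuous q := ((continuous_toUnramifiedQuot K S).comp continuous_subtype_val).subtype_mk _
    have hqs : Function.Surjective q := fun h ↦
      ⟨⟨Quotient.out (h : GaloisGroupUnramifiedOutside K S), hmemK _ h (hout h)⟩, Subtype.ext (hout h)⟩
    have hq : Topology.IsQuotientMap q := hqc.isClosedMap.isQuotientMap hqc hqs
    refine hq.continuous_iff.mpr ?_
    have hcomp : z ∘ q = fun s ↦ ψ.symm (f.1 s) := by
      funext s
      show ψ.symm (f.1 ⟨_, _⟩) = ψ.symm (f.1 s)
      congr 1
      exact hwd _ _ _ s.2 (hout (q s))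
    rw [hcomp]
    exact (continuous_of_discreteTopology (f := (ψ.symm : M → A))).comp f.1.continuous
  · -- the crossed-homomorphism identity
    intro h₁ h₂
    set s₁ := Quotient.out (h₁ : GaloisGroupUnramifiedOutside K S) with hs₁
    set s₂ := Quotient.out (h₂ : GaloisGroupUnramifiedOutside K S) with hs₂
    have hs₁K : s₁ ∈ κ.kerSubgroup := hmemK _ h₁ (hout h₁)
    have hs₂K : s₂ ∈ κ.kerSubgroup := hmemK _ h₂ (hout h₂)
    have h12 : toUnramifiedQuot K S (s₁ * s₂) = (h₁ * h₂ : galoisGroupAbove S κ.kerSubgroup) := by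
      rw [map_mul, hout h₁, hout h₂, Subgroup.coe_mul]
    apply ψ.injective
    have e12 := hzval ⟨s₁ * s₂, mul_mem hs₁K hs₂K⟩ (h₁ * h₂) h12
    have e1 := hzval ⟨s₁, hs₁K⟩ h₁ (hout h₁)
    have e2 := hzval ⟨s₂, hs₂K⟩ h₂ (hout h₂)
    have hmul : (⟨s₁ * s₂, mul_mem hs₁K hs₂K⟩ : κ.kerSubgroup) = ⟨s₁, hs₁K⟩ * ⟨s₂, hs₂K⟩ := rfl
    rw [e12, hmul, f.2, map_add, e1, ← hout h₁, hψ, e2]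
    rfl

include hψ in
/-- **Cohomological surjectivity of the Shapiro descent, cocycle level**: every continuous crossed homomorphism `f` of
`ker κ` with values in `M` VANISHING ON `N_S` is `F` of a class of `H¹(K_Σ/K, 𝐃₁)` — §1 descent to `Gal(K_S/K_∞)`, then
bsd-stepL's cocycle-level Shapiro surjectivity `BigRepModule.exists_cocycle_apply_zero_eq` (`c(g)(x) = ρ₀(σ x) z(σ(x)⁻¹ g σ(x − κ̄ g))`)
with a continuous homomorphic section `σ` of `κ̄` (`exists_continuousMonoidHom_section_padicInt`, `G_{K,S}` profinite).
[cite: SkinnerUrban2014, Prop. 3.2.3 (proof)] [cite: SerreGaloisCohomology1997, I §2.5] [cite: Greenberg2006, Thm. 3 p. 342] -/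
theorem exists_shapiroDescent_eq_of_apply_ramificationSubgroup_eq_zero (hA : ∀ a : A, ∃ k : ℕ, p ^ k • a = 0)
    {F : (bigRep (κ.liftUnramifiedOutside S hS) ρ₀).H 1 →+ subgroupH1 κ.kerSubgroup M}
    (hF : ∀ (c : contOneCocycles (bigRep (κ.liftUnramifiedOutside S hS) ρ₀).toTopRep)
      (z : contOneCocycles (discreteTopRep κ.kerSubgroup M)),
      (∀ h : κ.kerSubgroup, z.1 h = ψ ((c.1 (toUnramifiedQuot K S h) : BigRepModule ℤ_[p] p A) 0)) →
      F (oneCocycleClass _ c) = oneCocycleClass _ z)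
    (f : contOneCocycles (discreteTopRep κ.kerSubgroup M))
    (hf0 : ∀ (n : absoluteGaloisGroup K) (hn : n ∈ ramificationSubgroup K S),
      f.1 ⟨n, ramificationSubgroup_le_kerSubgroup_of_hS S hS κ hn⟩ = 0) :
    ∃ ξ : (bigRep (κ.liftUnramifiedOutside S hS) ρ₀).H 1, F ξ = oneCocycleClass _ f := by
  haveI : TotallyDisconnectedSpace (GaloisGroupUnramifiedOutside K S) :=
    Literature.GroupTheory.ProfiniteSubquotients.totallyDisconnectedSpace_quotient (ramificationSubgroup K S)
      (ramificationSubgroup_isClosed K S)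
  -- descent to `Gal(K_S/K_∞)`
  obtain ⟨z, hzc, hz, hzval⟩ := exists_cocycle_descent₁ S hS κ ρ₀ ψ hψ f hf0
  -- a continuous homomorphic section of `κ̄`
  obtain ⟨g₁, hg₁⟩ := κ.liftUnramifiedOutside_surjective S hS (ofAdd 1)
  obtain ⟨σ, hσ⟩ := Literature.GroupTheory.exists_continuousMonoidHom_section_padicInt
    (κ.liftUnramifiedOutside S hS) g₁ hg₁
  have hH : ∀ g : GaloisGroupUnramifiedOutside K S,
      g ∈ galoisGroupAbove S κ.kerSubgroup ↔ κ.liftUnramifiedOutside S hS g = 1 := by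
    intro g
    constructor
    · intro hg
      obtain ⟨τ, hτ, rfl⟩ := (mem_galoisGroupAbove_iff S _ g).1 hg
      rw [ZpExtension.liftUnramifiedOutside_mk]
      exact ZpExtension.mem_kerSubgroup.1 hτ
    · intro h1
      obtain ⟨τ, rfl⟩ := toUnramifiedQuot_surjective K S g
      exact (mem_galoisGroupAbove_iff S _ _).2 ⟨τ, ZpExtension.mem_kerSubgroup.2 h1, rfl⟩
  -- the one-variable Shapiro kit, cocycle level
  obtain ⟨c, hcont, hc, hcz⟩ := BigRepModule.exists_cocycle_apply_zero_eq
    (κ := κ.liftUnramifiedOutside S hS) (ρ := ρ₀) (σ := σ) hσ hA hH z hzc hz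
  refine ⟨oneCocycleClass _ ⟨⟨c, hcont⟩, fun g h ↦ hc g h⟩, hF _ f fun h ↦ ?_⟩
  have hmem : toUnramifiedQuot K S (h : absoluteGaloisGroup K) ∈ galoisGroupAbove S κ.kerSubgroup :=
    Subgroup.mem_map_of_mem _ h.2
  have e : c (toUnramifiedQuot K S (h : absoluteGaloisGroup K)) 0 = z ⟨_, hmem⟩ := hcz ⟨_, hmem⟩
  change f.1 h = ψ (c (toUnramifiedQuot K S (h : absoluteGaloisGroup K)) 0)
  rw [e, hzval h ⟨_, hmem⟩ rfl]

include hψ in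
/-- **The Shapiro descent is ONTO the classes of `H¹(K_∞, M)` unramified outside `S`** (`S ⊇ {w ∣ p}`,
`GreenbergVatsal2000.unramifiedOutside (ker κ) M p S` = unramified at every place of `K_∞` above each finite `w ∉ S`): such a
class restricts to zero on `N_S` (w4 g4's `resOfLe_eq_zero_of_mem_unramifiedOutside`: `N_S` is topologically normally generated by
the inertia groups outside `S` and acts trivially on `M`), so a representing cocycle vanishes on `N_S` and the previous theorem
applies. With LEAD g2's `conjH1_shapiroDescent_mem_unramifiedKer_of_not_mem` (the image IS unramified outside `S`) this is
`F : H¹(K_Σ/K, 𝐃₁) ≅ H¹(K_Σ/K_∞, M)` read inside `H¹(K_∞, M)`. [cite: Greenberg2006, Thm. 3 p. 342] [cite: GreenbergVatsal2000, §2 pp. 16–17, 23]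
[cite: NeukirchSchmidtWingberg2008, (1.6.7), VIII §3] -/
theorem exists_shapiroDescent_eq_of_mem_unramifiedOutside (hA : ∀ a : A, ∃ k : ℕ, p ^ k • a = 0)
    {F : (bigRep (κ.liftUnramifiedOutside S hS) ρ₀).H 1 →+ subgroupH1 κ.kerSubgroup M}
    (hF : ∀ (c : contOneCocycles (bigRep (κ.liftUnramifiedOutside S hS) ρ₀).toTopRep)
      (z : contOneCocycles (discreteTopRep κ.kerSubgroup M)),
      (∀ h : κ.kerSubgroup, z.1 h = ψ ((c.1 (toUnramifiedQuot K S h) : BigRepModule ℤ_[p] p A) 0)) →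
      F (oneCocycleClass _ c) = oneCocycleClass _ z)
    (y : subgroupH1 κ.kerSubgroup M) (hy : y ∈ GreenbergVatsal2000.unramifiedOutside κ.kerSubgroup M p S) :
    ∃ ξ : (bigRep (κ.liftUnramifiedOutside S hS) ρ₀).H 1, F ξ = y := by
  obtain ⟨f, rfl⟩ := oneCocycleClass_surjective _ y
  -- `Σ = S ∪ {w ∣ p} (= S)`: `N_Σ ≤ ker κ`, `N_Σ` acts trivially on `M`
  have hSub : S ∪ {v : HeightOneSpectrum (𝓞 K) | ((p : ℕ) : 𝓞 K) ∈ v.asIdeal} ⊆ S := fun v hv ↦ hv.elim id (hS v)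
  have hS' : ∀ v : HeightOneSpectrum (𝓞 K), ((p : ℕ) : 𝓞 K) ∈ v.asIdeal →
      v ∈ S ∪ {v : HeightOneSpectrum (𝓞 K) | ((p : ℕ) : 𝓞 K) ∈ v.asIdeal} := fun v hv ↦ Or.inr hv
  have hNH : ramificationSubgroup K (S ∪ {v : HeightOneSpectrum (𝓞 K) | ((p : ℕ) : 𝓞 K) ∈ v.asIdeal}) ≤ κ.kerSubgroup :=
    ramificationSubgroup_le_kerSubgroup_of_hS _ hS' κ
  have htriv : ∀ σ ∈ ramificationSubgroup K (S ∪ {v : HeightOneSpectrum (𝓞 K) | ((p : ℕ) : 𝓞 K) ∈ v.asIdeal}),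
      ∀ m : M, σ • m = m := by
    intro σ hσ m
    have h1 : toUnramifiedQuot K S σ = 1 :=
      (QuotientGroup.eq_one_iff σ).mpr (ramificationSubgroup_mono Set.subset_union_left hσ)
    rw [← ψ.apply_symm_apply m, ← hψ, h1, map_one]
    rfl
  have hres := resOfLe_eq_zero_of_mem_unramifiedOutside κ.isClosed_kerSubgroup hNH htriv hy
  rw [resOfLe, Literature.NumberTheory.EllipticCurves.resH1Hom_oneCocycleClass, oneCocycleClass_eq_zero_iff] at hres
  obtain ⟨a, ha⟩ := hres
  refine exists_shapiroDescent_eq_of_apply_ramificationSubgroup_eq_zero S hS κ ρ₀ ψ hψ hA hF f fun n hn ↦ ?_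
  have hn' : n ∈ ramificationSubgroup K (S ∪ {v : HeightOneSpectrum (𝓞 K) | ((p : ℕ) : 𝓞 K) ∈ v.asIdeal}) :=
    ramificationSubgroup_mono hSub hn
  have h := ha ⟨n, hn'⟩
  rw [pullback_resHomOfEquivariant_apply, AddMonoidHom.id_apply] at h
  have h' : f.1 ⟨n, hNH hn'⟩ = n • a - a := h
  rw [htriv n hn' a, sub_self] at h'
  exact h'

include hψ in
/-- **Converse of LEAD g2's `conjH1_shapiroDescent_mem_awayKer_of_loc_eq_zero`: if EVERY conjugate `conj_σ(F[c])`, `σ ∈ Γ_K`,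
is locally trivial above the finite place `w` over `K_∞` (`awayKer`), then Greenberg's localisation `loc_w[c]` VANISHES.**
bsd-stepL's criterion `exists_eq_bigRep_sub_comp_iff` asks that every evaluation `τ ↦ c(τ̄)(x)`, `x ∈ ℤ_p`, be principal on the
`τ ∈ Γ_{K_w}` over `ker κ`; `x = κ(σ)` for some `σ` (`κ` onto), and `rho_apply_conj_zero` turns the conjugate by `σ` of the
Shapiro cocycle into that evaluation up to a coboundary. [cite: SkinnerUrban2014, §3.1.2 ((3.1.2.a)–(3.1.2.b)) and Prop. 3.2.3]
[cite: GreenbergVatsal2000, §2 p. 17] -/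
theorem loc_eq_zero_of_forall_conjH1_shapiroDescent_mem_awayKer [IsTopologicalRing (PowerSeries ℤ_[p])]
    (hA : ∀ a : A, ∃ k : ℕ, p ^ k • a = 0)
    {F : (bigRep (κ.liftUnramifiedOutside S hS) ρ₀).H 1 →+ subgroupH1 κ.kerSubgroup M}
    (hF : ∀ (c : contOneCocycles (bigRep (κ.liftUnramifiedOutside S hS) ρ₀).toTopRep)
      (z : contOneCocycles (discreteTopRep κ.kerSubgroup M)),
      (∀ h : κ.kerSubgroup, z.1 h = ψ ((c.1 (toUnramifiedQuot K S h) : BigRepModule ℤ_[p] p A) 0)) →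
      F (oneCocycleClass _ c) = oneCocycleClass _ z)
    (w : HeightOneSpectrum (𝓞 K)) (c : contOneCocycles (bigRep (κ.liftUnramifiedOutside S hS) ρ₀).toTopRep)
    (hw : ∀ σ : absoluteGaloisGroup K,
      conjH1 κ.kerSubgroup M σ (F (oneCocycleClass _ c)) ∈ awayKer κ.kerSubgroup M w) :
    loc S (bigRep (κ.liftUnramifiedOutside S hS) ρ₀) (Sum.inr w) 1 (oneCocycleClass _ c) = 0 := by
  haveI : CompactSpace (absoluteGaloisGroup (Place.Completion (Sum.inr w : Place K))) :=
    absoluteGaloisGroup_compactSpace _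
  obtain ⟨z, hz⟩ := exists_shapiroCocycle S hS κ ρ₀ ψ hψ c
  have hc : ∀ g h : GaloisGroupUnramifiedOutside K S, (c.1 (g * h) : BigRepModule ℤ_[p] p A) =
      c.1 g + bigRep (κ.liftUnramifiedOutside S hS) ρ₀ g (c.1 h) := fun g h ↦ c.2 g h
  rw [loc_bigRep_oneCocycleClass_eq_zero_iff]
  refine (BigRepModule.exists_eq_bigRep_sub_comp_iff (κ.liftUnramifiedOutside S hS) ρ₀
    (localToUnramified S (Sum.inr w : Place K)) hA c.1.continuous hc).2 fun x ↦ ?_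
  -- `x = κ σ`
  obtain ⟨σ, hσ⟩ := κ.surjective (ofAdd x)
  have hσ' : κ σ = ofAdd x := hσ
  have hσx : (κ σ).toAdd = x := by rw [hσ', toAdd_ofAdd]
  have hwσ := hw σ
  rw [hF c z hz, awayKer, AddMonoidHom.mem_ker,
    Literature.NumberTheory.EllipticCurves.BigGaloisRep.resOfLe_conjH1_oneCocycleClass_eq_zero_iff] at hwσ
  obtain ⟨m, hm⟩ := hwσ
  set b : A := (c.1 (toUnramifiedQuot K S σ) : BigRepModule ℤ_[p] p A) x with hb
  refine ⟨ψ.symm m - b, fun τ hτ ↦ ?_⟩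
  -- the element `y = τ|_{K̄} ∈ ker κ ⊓ D_w`
  set yv : absoluteGaloisGroup K := absGaloisRestrict K _ τ with hyv
  have hτ' : localToUnramified S (Sum.inr w : Place K) τ = toUnramifiedQuot K S yv := rfl
  have hyD : yv ∈ decomp (K := K) w := (mem_decomp_iff w _).2 ⟨τ, rfl⟩
  have hyK1 : κ yv = 1 := by rw [← ZpExtension.liftUnramifiedOutside_mk S κ hS yv, ← hτ']; exact hτ
  have hyK : yv ∈ κ.kerSubgroup := ZpExtension.mem_kerSubgroup.2 hyK1
  have hyq : κ.liftUnramifiedOutside S hS (toUnramifiedQuot K S yv) = 1 := by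
    rw [ZpExtension.liftUnramifiedOutside_mk]; exact hyK1
  let y : ↥(κ.kerSubgroup ⊓ decomp (K := K) w) := ⟨yv, Subgroup.mem_inf.2 ⟨hyK, hyD⟩⟩
  have hmy := hm y
  -- the conjugation identity, read at `x = κ σ`
  have key := BigRepModule.rho_apply_conj_zero (κ.liftUnramifiedOutside S hS) ρ₀ hc (toUnramifiedQuot K S σ) hyq
  rw [ZpExtension.liftUnramifiedOutside_mk, hσx] at key
  have hq : toUnramifiedQuot K S (σ⁻¹ * yv * σ) =
      (toUnramifiedQuot K S σ)⁻¹ * toUnramifiedQuot K S yv * toUnramifiedQuot K S σ := by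
    rw [map_mul, map_mul, map_inv]
  -- `hmy`: `σ • ψ(c(σ⁻¹ y σ)(0)) = y • m − m`
  simp only [hz, subgroupConj_apply_coe, subgroupInclusion_apply_coe] at hmy
  change σ • ψ ((c.1 (toUnramifiedQuot K S (σ⁻¹ * yv * σ)) : BigRepModule ℤ_[p] p A) 0) = yv • m - m at hmy
  rw [hq, ← hψ, key] at hmy
  -- conclude in `A` by injectivity of `ψ`
  rw [map_add ψ, map_sub ψ, hψ] at hmy
  rw [hτ']
  apply ψ.injective
  rw [map_sub ψ, hψ, map_sub ψ, ψ.apply_symm_apply, smul_sub]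
  calc ψ ((c.1 (toUnramifiedQuot K S yv) : BigRepModule ℤ_[p] p A) x)
      = (ψ ((c.1 (toUnramifiedQuot K S yv) : BigRepModule ℤ_[p] p A) x) + (yv • ψ b - ψ b)) - (yv • ψ b - ψ b) := by
        abel
    _ = (yv • m - m) - (yv • ψ b - ψ b) := by rw [hmy]
    _ = yv • m - yv • ψ b - (m - ψ b) := by abel

end Onto

end Summit.BirchSwinnertonDyer.BirchSwinnertonDyer.Theorems.AcTwistDeformation

end
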